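import Summits.QuantumFields.BalabanUV.Beta.GAN24.DecimatedKernelLegs
import Summits.QuantumFields.BalabanUV.Beta.GAN24.E3UnitSplitLevelsVSymAt

/-!
# `BalabanUV.Beta.GAN24.DecimatedKernelLegsSymAt` (SYMMETRIC comb table AT THE IN-BLOCK ROOT; corner-root bases `DilatedBorderThirdJet` §3–§4 and
# `DecimatedKernelLegs.succ_piece_eq_e3K3_unitK`) — binder row G-an2-4 ∕ (CONV-C), road S3, DIFF row R3-dV parts 1 ∕ 4 RE-RUN FOR an2's ROOTED BORDER TABLE
# `DecLiftAdjoint.borderSum M (vhSAt (toSite r) d Lc)` — «ROOTED-S3-V-DIFF» part (b): **MEMBER `n+3`'s ROOTED PUSHED BORDER PIECE IS MEMBER `n+2`'s ROOTED TABLE READ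
# THROUGH THE `Lc`-DECIMATED RESOLVENT** (`succ_piece_eq_e3K3_unitK_at`), by the GENERIC dilation covariance `DilationCovariance.borderSum_mul` (any level table `G`)

NOT IN PRINT; OUR BOOKKEEPING (G-an2-4 formalisation swarm → CRUX TEAM (2), leaf prover `b2b-balaban-gan24-formalise-leaf-04`, gen 57; journal `CLAIMS.log`
INTENT «ROOTED-S3-V-DIFF»).  The owner gan24-p1's gen-6 `mkroot.py` METHOD: the base proofs VERBATIM with `borderInc d Lc M κ u ↦ borderSum M (fun κ₀ z₀ =>
vhSAt (toSite r) d Lc rfl κ₀ z₀) κ u`, one extra binder `(hr : r ∈ box (d+1) Lc)`; the table-specific inputs replaced by their rooted twins typed HERE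
(`locStencil_borderSumV` = an2's `locStencil_borderInc` with an1's rooted `locStencil_vhSAt`; `pushSum_borderSumV_mul_eq_borderSum` = leaf-05's
`pushSum_borderInc_mul` over the GENERIC `borderSum_mul`; `locStencil_pushSum_borderSumV_one`, `e3OfS_pushed_borderSumV_succ` ∕ `_pow_succ` over the GENERIC
`DilatedBorderThirdJet.e3OfS_borderSum_eq_e3K_dec`) and p2 g33's rooted block vanishing `E3UnitSplitLevelsVSymAt.pushSum_borderSumV_inl_inl` ∕ `…_inr_inr` BY
NAME; base modules untouched.  [folklore]; 0 `def`, 0 cited facts, 0 `def … : Prop`, 0 sorry; NO estimate on Bałaban's kernels.  HONEST FRAMING (cell contract,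
verbatim): «discharging `BetaPertH` makes Bałaban's UV stability UNCONDITIONAL — a real constructive-QFT result; it is NOT the continuum limit and NOT the Clay
problem.»  HONEST DEPENDENCY (verbatim): «continuum YM on T⁴ ⇐ BetaPertH ∧ nine spine estimates (0/9 proved); BetaPertH ⇐ (D1) ∧ (D4) ∧ CAP+tail; G-an2-4 gates
asym, D1 and NE2/3/4.»  Discharges NOTHING of «E3SupRate» ∕ (hS, hSall) ∕ hBdev by itself; NEVER «G-an2-4 closed»; NOT D1, NOT BetaPertH, NOT continuum, NOT Clay.
Unit `b2b-balaban-gan24-formalise-leaf-04` (gen 57), 2026-08-21.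
-/

noncomputable section

open Finset
open scoped BigOperators
open Literature.MathematicalPhysics.QuantumFieldTheory
open Literature.MathematicalPhysics.QuantumFieldTheory.Balaban1983to89
open Literature.MathematicalPhysics.QuantumFieldTheory.Balaban1983to89.Beta
open LatticeForm (quo)
open B12Sec2to5 (l1 l1_nonneg)
open ExpKernelCalculus (MKer Decays BiLoc)
open OneStepResolventKernel (Fib LocStencil KInv biLoc_finset_sum)
open OneStepKernelFamily (dec)
open StepJetData (biLoc_weaken)
open AveragingHessianKernels (ell)
open AveragingHessianKernelsRooted (vhSAt locStencil_vhSAt)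
open AffineAveraging (box toSite)
open InterLevelTransport (avgLift biLoc_avgLift)
open BalabanCompositeJets (pushSum bshift biLoc_pushSum biLoc_recenter l1_sub_blockBase_le)
open DecLiftAdjoint (borderSum)
open Summit.QuantumFields.BalabanUV.Beta.HessKerDressedUnits (unitK)
open Summit.QuantumFields.BalabanUV.Beta.GAN24.E3UnitSplit (e3OfS)
open Summit.QuantumFields.BalabanUV.Beta.GAN24.E3UnitSplitLevelsVSymAt (pushSum_borderSumV_inl_inl pushSum_borderSumV_inr_inr)
open Summit.QuantumFields.BalabanUV.Beta.GAN24.ThirdJetKernel (e3K)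
open Summit.QuantumFields.BalabanUV.Beta.GAN24.ThirdJetThreeKernel (e3K3 e3K3_self e3K3_smul e3K3_unitK_offdiag)
open Summit.QuantumFields.BalabanUV.Beta.GAN24.ScaleNesting (pushSum_avgLift)
open Summit.QuantumFields.BalabanUV.Beta.GAN24.PushSumNest (pushSum_finset_sum)
open Summit.QuantumFields.BalabanUV.Beta.GAN24.DilationCovariance (borderSum_mul)
open Summit.QuantumFields.BalabanUV.Beta.GAN24.DilatedBorderThirdJet (e3OfS_borderSum_eq_e3K_dec)

namespace Summit.QuantumFields.BalabanUV.Beta.GAN24.DecimatedKernelLegsSymAt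

variable {d : ℕ} {Lc : ℕ} [NeZero Lc]

/-! ## §1 The rooted symmetric border table: locality and dilation covariance -/

omit [NeZero Lc] in
/-- [folklore] **THE ROOTED SYMMETRIC BORDER TABLE IS A LOCAL STENCIL FAMILY** at every rate `δ ≥ 0` (an1's rooted `vhSAt` is finite-range: `locStencil_vhSAt`),
SAME constant as an2's `locStencil_borderInc`: `M · 3ℓ(Lc)²·e^{4(d+1)·Lc·Mδ} · e^{4(d+1)·Mδ} · e^{2δ(d+2)M}` (its proof verbatim, the one-step table swapped). -/
theorem locStencil_borderSumV {M : ℕ} [NeZero M] (hLc : 1 ≤ Lc) {r : Fin (d + 1) → ℕ} (hr : r ∈ box (d + 1) Lc) {δ : ℝ} (hδ : 0 ≤ δ) :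
    LocStencil (borderSum M (fun κ₀ z₀ => vhSAt (toSite r) d Lc rfl κ₀ z₀))
      (M * (3 * (ell (d + 1) Lc : ℝ) ^ 2 * Real.exp (4 * ((d : ℝ) + 1) * Lc * (M * δ)) * Real.exp (4 * (d + 1) * (M * δ)) *
        Real.exp (2 * δ * ((d + 2) * M)))) δ := by
  have hM0 : (M : ℝ) ≠ 0 := by exact_mod_cast NeZero.ne M
  have hMδ : 0 ≤ (M : ℝ) * δ := mul_nonneg (Nat.cast_nonneg M) hδ
  intro κ u
  set C0 := 3 * (ell (d + 1) Lc : ℝ) ^ 2 * Real.exp (4 * ((d : ℝ) + 1) * Lc * (M * δ)) * Real.exp (4 * (d + 1) * (M * δ)) with hC0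
  have hC0nn : 0 ≤ C0 := by positivity
  have hterm : ∀ s ∈ Finset.range M,
      BiLoc (avgLift M (vhSAt (toSite r) d Lc rfl κ (quo M (u - bshift d κ s)))) u u (C0 * Real.exp (2 * δ * ((d + 2) * M))) δ := by
    intro s hs
    set z := quo M (u - bshift d κ s) with hz
    have hG : BiLoc (vhSAt (toSite r) d Lc rfl κ z) z z
        (3 * (ell (d + 1) Lc : ℝ) ^ 2 * Real.exp (4 * ((d : ℝ) + 1) * Lc * (M * δ))) (M * δ) :=
      locStencil_vhSAt hLc hr hMδ κ z
    have hA := biLoc_avgLift M hG hMδ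
    rw [mul_div_cancel_left₀ δ hM0] at hA
    have hR := biLoc_recenter hA hδ u
    refine biLoc_weaken hR ?_ le_rfl
    refine mul_le_mul_of_nonneg_left (Real.exp_le_exp.2 ?_) hC0nn
    exact mul_le_mul_of_nonneg_left (l1_sub_blockBase_le M u κ (Finset.mem_range.1 hs)) (by positivity)
  have hsum := biLoc_finset_sum (Finset.range M) hterm
  simp only [Finset.sum_const, Finset.card_range, nsmul_eq_mul] at hsum
  exact hsum

/-- [folklore] **DILATION COVARIANCE OF THE PUSHED ROOTED BORDER TABLE** (leaf-05's `pushSum_borderInc_mul` ∕ `DilatedBorderThirdJet.pushSum_borderInc_mul_eq_borderSum`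
for the rooted symmetric table, over the GENERIC `DilationCovariance.borderSum_mul`): `pushSum (Lc·M′) L ∘ borderSum (Lc·M) V = borderSum Lc (pushSum M′ L ∘ borderSum M V)`. -/
theorem pushSum_borderSumV_mul_eq_borderSum (r : Fin (d + 1) → ℕ) (M M' L : ℕ) :
    (fun κ u => pushSum (Lc * M') L (borderSum (Lc * M) (fun κ₀ z₀ => vhSAt (toSite r) d Lc rfl κ₀ z₀) κ u)) =
      borderSum Lc (fun κ z => pushSum M' L (borderSum M (fun κ₀ z₀ => vhSAt (toSite r) d Lc rfl κ₀ z₀) κ z)) := by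
  funext κ u
  have e : borderSum (Lc * M) (fun κ₀ z₀ => vhSAt (toSite r) d Lc rfl κ₀ z₀) κ u =
      ∑ t ∈ Finset.range Lc, avgLift Lc (borderSum M (fun κ₀ z₀ => vhSAt (toSite r) d Lc rfl κ₀ z₀) κ (quo Lc (u - bshift d κ t))) := by
    rw [borderSum_mul]
    funext x w a b
    simp only [Finset.sum_apply]
  rw [e, pushSum_finset_sum]
  funext x w a b
  simp only [Finset.sum_apply, pushSum_avgLift, borderSum]

omit [NeZero Lc] in
/-- [folklore] **THE PUSHED ROOTED BORDER TABLE IS A LOCAL STENCIL FAMILY** (rate `1`, explicit constant: `locStencil_borderSumV` at `δ = 1` pushed by an2's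
`biLoc_pushSum`; only used to feed the Fubini hypotheses of `e3OfS_borderSum_eq_e3K_dec`). -/
theorem locStencil_pushSum_borderSumV_one (hLc : 1 ≤ Lc) {r : Fin (d + 1) → ℕ} (hr : r ∈ box (d + 1) Lc) (M M' L : ℕ) [NeZero M] [NeZero M'] [NeZero L]
    (hL : 1 ≤ L) :
    LocStencil (fun κ z => pushSum M' L (borderSum M (fun κ₀ z₀ => vhSAt (toSite r) d Lc rfl κ₀ z₀) κ z))
      ((M * (3 * (ell (d + 1) Lc : ℝ) ^ 2 * Real.exp (4 * ((d : ℝ) + 1) * Lc * (M * 1)) * Real.exp (4 * (d + 1) * (M * 1)) *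
        Real.exp (2 * 1 * ((d + 2) * M)))) * (((L : ℝ) ^ (d + 2)) ^ 2) * Real.exp (4 * ((d : ℝ) + 1) * M' * L * 1)) 1 := by
  intro κ z
  exact biLoc_pushSum hL (locStencil_borderSumV (d := d) (M := M) hLc hr zero_le_one κ z) zero_le_one

/-! ## §2 Member `n+3`'s rooted piece in member `n+2`'s form -/

/-- [folklore] **`e3OfS_pushed_borderSumV_succ` — MEMBER `p+1`'s PUSHED ROOTED BORDER PIECE THROUGH ITS ONE-SHOT RESOLVENT IS THE THIRD-JET FUNCTIONAL OF MEMBER `p`'s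
ROOTED TABLE THROUGH THE `Lc`-DECIMATED RESOLVENT** (exact; generic `d`; `N′ = Lc·N`, any `M, M′, L ≥ 1`, any weight `c`; the base's `e3OfS_pushed_border_succ`). -/
theorem e3OfS_pushed_borderSumV_succ (hLc : 1 ≤ Lc) {r : Fin (d + 1) → ℕ} (hr : r ∈ box (d + 1) Lc) {N N' : ℕ} [NeZero N] [NeZero N'] (hN : N' = Lc * N)
    (M M' L : ℕ) [NeZero M] [NeZero M'] [NeZero L] (hL : 1 ≤ L) (c : ℝ) (κ' : Fin (d + 1)) (u' : Fin (d + 1) → ℤ) :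
    e3OfS N' (fun κ u => c • pushSum (Lc * M') L (borderSum (Lc * M) (fun κ₀ z₀ => vhSAt (toSite r) d Lc rfl κ₀ z₀) κ u)) κ' u' =
      e3K (dec Lc (KInv (N := N') (d := d))) N
        (fun κ z => (c * (Lc : ℝ) ^ (d + 2)) • pushSum M' L (borderSum M (fun κ₀ z₀ => vhSAt (toSite r) d Lc rfl κ₀ z₀) κ z)) κ' u' := by
  have h := e3OfS_borderSum_eq_e3K_dec (d := d) hN (locStencil_pushSum_borderSumV_one (d := d) hLc hr M M' L hL) one_pos c κ' u'
  rw [← pushSum_borderSumV_mul_eq_borderSum] at h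
  exact h

/-- [folklore] **ROW dV's FIRST LINE, ROOTED SYMMETRIC TABLE** (the literal shapes of `TaylorRowVSymAt.rowV_three_at` one member up, member `n+3` side):
`e3OfS (Lc^{n+3}) (w • pushSum (Lc^{m+3}) (Lc^{n−m}) ∘ borderSum (Lc^{m+2}) (vhSAt ρ)) κ′ u′
   = e3K (dec Lc (KInv (Lc^{n+3}))) (Lc^{n+2}) ((w·Lc^{d+2}) • pushSum (Lc^{m+2}) (Lc^{n−m}) ∘ borderSum (Lc^{m+1}) (vhSAt ρ)) κ′ u′`
— member `n+3`'s depth-`(n−m)` piece is member `n+2`'s depth-`(n−m)` table read through the `Lc`-decimated level-`(n+3)` resolvent. -/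
theorem e3OfS_pushed_borderSumV_pow_succ (hLc : 1 ≤ Lc) {r : Fin (d + 1) → ℕ} (hr : r ∈ box (d + 1) Lc) (n m : ℕ) (w : ℝ) (κ' : Fin (d + 1)) (u' : Fin (d + 1) → ℤ) :
    e3OfS (Lc ^ (n + 1 + 1 + 1))
        (fun κ u => w • pushSum (Lc ^ (m + 1 + 1 + 1)) (Lc ^ (n - m)) (borderSum (Lc ^ (m + 1 + 1)) (fun κ₀ z₀ => vhSAt (toSite r) d Lc rfl κ₀ z₀) κ u)) κ' u' =
      e3K (dec Lc (KInv (N := Lc ^ (n + 1 + 1 + 1)) (d := d))) (Lc ^ (n + 1 + 1))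
        (fun κ z => (w * (Lc : ℝ) ^ (d + 2)) • pushSum (Lc ^ (m + 1 + 1)) (Lc ^ (n - m)) (borderSum (Lc ^ (m + 1)) (fun κ₀ z₀ => vhSAt (toSite r) d Lc rfl κ₀ z₀) κ z)) κ' u' := by
  have hL : 1 ≤ Lc ^ (n - m) := Nat.one_le_pow _ _ (Nat.lt_of_lt_of_le Nat.zero_lt_one hLc)
  have e1 : Lc ^ (m + 1 + 1 + 1) = Lc * Lc ^ (m + 1 + 1) := pow_succ' Lc (m + 1 + 1)
  have e2 : Lc ^ (m + 1 + 1) = Lc * Lc ^ (m + 1) := pow_succ' Lc (m + 1)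
  have h := e3OfS_pushed_borderSumV_succ (d := d) hLc hr (N := Lc ^ (n + 1 + 1)) (N' := Lc ^ (n + 1 + 1 + 1)) (pow_succ' Lc (n + 1 + 1))
    (Lc ^ (m + 1)) (Lc ^ (m + 1 + 1)) (Lc ^ (n - m)) hL w κ' u'
  rw [← e2, ← e1] at h
  exact h


/-! ## §3 Row dV's member-`(n+3)` side in member-`(n+2)` form, rooted -/

/-- [folklore] **`succ_piece_eq_e3K3_unitK_at` — THE BASE's `succ_piece_eq_e3K3_unitK` FOR THE ROOTED SYMMETRIC TABLE** (exact; generic `d`, `1 ≤ Lc`, every in-block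
root `r`): member `n+3`'s rooted pushed border piece, unit-rescaled, IS the three-leg functional `e3K3 K♮ K♮ K♮` of member `n+2`'s rooted table,
`K♮ = unitK Lc Lc^{d+1} (dec Lc (KInv (Lc^{n+3})))` — the first line of the rooted DIFF row `S3DiffVSymAt`. -/
theorem succ_piece_eq_e3K3_unitK_at (hLc : 1 ≤ Lc) {r : Fin (d + 1) → ℕ} (hr : r ∈ box (d + 1) Lc) (cVH : ℝ) (n m : ℕ) (κ' : Fin (d + 1)) (u' x z : Fin (d + 1) → ℤ) (a b : Fib d) :
    ((Lc : ℝ) ^ (n + 1 + 1 + 1)) ^ (2 * (d + 1)) *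
        e3OfS (Lc ^ (n + 1 + 1 + 1))
          (fun κ u => ((((Lc : ℝ) ^ (d + 1)) ^ (n - m) * (cVH * ((Lc : ℝ) ^ (m + 1 + 1)) ^ (d + 2))) •
            pushSum (Lc ^ (m + 1 + 1 + 1)) (Lc ^ (n - m)) (borderSum (Lc ^ (m + 1 + 1)) (fun κ₀ z₀ => vhSAt (toSite r) d Lc rfl κ₀ z₀) κ u))) κ' u' x z a b =
      ((Lc : ℝ) ^ (n + 1 + 1)) ^ (2 * (d + 1)) *
        e3K3 (unitK (Lc : ℝ) ((Lc : ℝ) ^ (d + 1)) (dec Lc (KInv (N := Lc ^ (n + 1 + 1 + 1)) (d := d))))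
          (unitK (Lc : ℝ) ((Lc : ℝ) ^ (d + 1)) (dec Lc (KInv (N := Lc ^ (n + 1 + 1 + 1)) (d := d))))
          (unitK (Lc : ℝ) ((Lc : ℝ) ^ (d + 1)) (dec Lc (KInv (N := Lc ^ (n + 1 + 1 + 1)) (d := d)))) (Lc ^ (n + 1 + 1))
          (fun κ u => ((((Lc : ℝ) ^ (d + 1)) ^ (n - m) * (cVH * ((Lc : ℝ) ^ (m + 1)) ^ (d + 2))) •
            pushSum (Lc ^ (m + 1 + 1)) (Lc ^ (n - m)) (borderSum (Lc ^ (m + 1)) (fun κ₀ z₀ => vhSAt (toSite r) d Lc rfl κ₀ z₀) κ u))) κ' u' x z a b := by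
  have hL0 : (Lc : ℝ) ≠ 0 := by exact_mod_cast NeZero.ne Lc
  have hsf : (Lc : ℝ) ≠ 0 := hL0
  have hsm : (Lc : ℝ) ^ (d + 1) ≠ 0 := pow_ne_zero _ hL0
  rw [e3OfS_pushed_borderSumV_pow_succ (d := d) hLc hr n m _ κ' u', ← e3K3_self,
    e3K3_unitK_offdiag hsf hsm _ _ _ _ _ (fun κ u x z α' β' => by
        simp only [Pi.smul_apply, smul_eq_mul, pushSum_borderSumV_inl_inl, mul_zero])
      (fun κ u x z μ ν => by simp only [Pi.smul_apply, smul_eq_mul, pushSum_borderSumV_inr_inr, mul_zero]),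
    e3K3_smul, e3K3_smul]
  simp only [Pi.smul_apply, smul_eq_mul]
  ring


end Summit.QuantumFields.BalabanUV.Beta.GAN24.DecimatedKernelLegsSymAt

end
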